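import Summits.BirchSwinnertonDyer.BirchSwinnertonDyer.Theorems.UniversalToricDescentThinCombFibredSupply
import HarnessLib

/-!
# The rational wall `RationalSplitIMCInclusionAtThree` (stmt-BirchSwinnertonDyer-24207), line `ratwall_thin_comb`: the CHARACTER GRID —
# the grid supply of interpolation characters WITH ITS TWO BASE CHARACTERS `χ`, `χ^τ` EXPOSED
# (`--supports stmt-BirchSwinnertonDyer-24207`; cell `pub/bsd-wall`, LEAD `cruxlead-24207` g38; nothing is closed; BSD is not proved)

WHY. `…ThinComb.GridSupply.gridSupply` (g37) records the grid of interpolation data `ψ_{ij}` of types `(m(i+1), −m(j+1))` through a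
`𝔭`-adapted pair together with the three one-units `u = χ(γ₁)`, `v₁ = χ(τγ₁)`, `v₂ = χ(τγ₂)` locating its points. The FRAME FUNCTIONAL
EQUATION (`…ThinComb.FrameFunctionalEquation`, this gen: `φ_{A_τ}L₂ = [g₀]·L₂` for a GROUP ELEMENT `g₀ ∈ Γ_K`, for every non-zero ♯♯-frame)
compares the reflected frame with `[g]·L₂` for group-like elements `[g]`, whose value at the point of `ψ_{ij}` is `r_{ij}(g)`
(`…GradingRenormalisation.hasValueAt₂_groupLike`). So one more feature of the same characters is needed, lost in the g37 packaging: the avatars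
are PRODUCTS OF POWERS OF TWO FIXED CHARACTERS through the pair, `r_{ij}(g) = r₁(g)^{i+1}·r₂(g)^{j+1}` for ALL `g ∈ Γ_K`, with `r₁ = χ` (the
vertical character: `r₁(γ₁) = u`, `r₁(γ₂) = 1`) and `r₂ = χ^τ = χ ∘ τ` (the reflected partner: `r₂(γ₁) = v₁`, `r₂(γ₂) = v₂`). This file re-runs
the construction of `gridSupply` and records exactly this (`characterGrid`); no new arithmetic.

HONEST SCOPE: bookkeeping of class field theory for the interpolation set of a two-variable `p`-adic `L`-function, modulo Jacquet's cone
fact for the continuation clause (BY NAME, as in `gridSupply`); nothing here is evidence that a toric frame exists at the additive split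
`3`; 24207 / 20395 / 20186 / 32493 OPEN; BSD is proved for no curve.

References: [Weil1956] §1–§2; [SerreAbelianLadic1968] Ch. III §2.3; [Jacquet1972] §19 Cor. 19.15; [BuyukbodukLei2017] Def. 3.8
(arXiv:1707.00557); [deShalit1987] II.1.4 Lemma (ii), II.4.17; [Washington1997] §13.1, Thm. 13.4; [Brink2007] Cor. 1.
-/

set_option linter.dupNamespace false
set_option autoImplicit false

noncomputable section

open scoped NumberField
open NumberField IsDedekindDomain Field
open Literature Literature.NumberTheory.GaloisRepresentations Literature.NumberTheory.EllipticCurves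
open Literature.NumberTheory.EllipticCurves.ModularForms
open Summit.BirchSwinnertonDyer.Rank1Residual.X11b.Three.LambdaSupply
open Summit.BirchSwinnertonDyer.BirchSwinnertonDyer.Theorems.PrintCf2
open Summit.BirchSwinnertonDyer.BirchSwinnertonDyer.Theorems.CycTangentCMCycTangentBoundSplitPrimePowerLine

namespace Summit.BirchSwinnertonDyer.BirchSwinnertonDyer.Theorems.UniversalToricDescentThinComb.CharacterGrid

variable {p : ℕ} [Fact p.Prime] {K : Type} [Field K] [NumberField K]

/-- **THE CHARACTER GRID OF INTERPOLATION DATA THROUGH THE PAIR.** In a `𝔭`-adapted frame of the `ℤ_p²`-tower of an imaginary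
quadratic `K` (`p` odd and split, `ι′` inducing `𝔭`, `κ₁` unramified outside `𝔭`), for a newform `f = Dt.f` of level `N` with the
Heegner hypothesis and any lift `τ` of `g ↦ c g⁻¹ c⁻¹` (`c ∉ res Γ_K`), there are TWO CHARACTERS `r₁, r₂` of `Γ_K` through the pair
(`r₁ = χ` the vertical character, `r₂ = χ ∘ τ` its reflected partner), one-units `u = r₁(γ₁)`, `v₁ = r₂(γ₁)`, `v₂ = r₂(γ₂)` of level `|p|`
with `r₁(γ₂) = 1`, `u` and `v₂` of infinite order, and `m > 0`, such that for ALL `i, j ≥ 0` there is an interpolation datum `(ψ, r, L)`: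
`ψ` everywhere unramified of type `(m(i+1), −m(j+1))`, `r` its `p`-adic avatar through the pair with `r(g) = r₁(g)^{i+1}·r₂(g)^{j+1}` for
EVERY `g ∈ Γ_K` (so `r(γ₁) = v₁^{j+1}·u^{i+1}`, `r(γ₂) = v₂^{j+1}`), and `L` an entire continuation of `L(f/K, ψ, s)` (Jacquet's cone fact).
[cite: Weil1956, §1–§2] [cite: Jacquet1972, §19 Cor. 19.15] [cite: BuyukbodukLei2017, Def. 3.8 (arXiv:1707.00557)]
[cite: deShalit1987, II.1.4 Lemma (ii)] [cite: Washington1997, §13.1, Thm. 13.4] -/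
theorem characterGrid (hJ : jacquet1972_functionalEquation_rankinSelbergHecke_cone) (hp2 : p ≠ 2)
    (hK : IsImaginaryQuadratic K) {N : ℕ} [NeZero N] (W : WeierstrassCurve ℚ)
    (Dt : Literature.NumberTheory.EllipticCurves.ModularForms.ModularParametrizationData W N)
    (hH : SatisfiesHeegnerHypothesis N K)
    {𝔭 : HeightOneSpectrum (𝓞 K)} (h3 : ((p : ℕ) : 𝓞 K) ∈ 𝔭.asIdeal)
    {𝔭' : HeightOneSpectrum (𝓞 K)} (h3' : ((p : ℕ) : 𝓞 K) ∈ 𝔭'.asIdeal) (hne : 𝔭' ≠ 𝔭)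
    (ι' : PadicAlgCl p ≃+* ℂ) (hι : ∀ (w : InfinitePlace K) (k : 𝓞 K), k ∈ 𝔭.asIdeal ↔ ‖ι'.symm (w.embedding (k : K))‖ < 1)
    {κ₁ κ₂ : ZpExtension K p} {γ₁ γ₂ : absoluteGaloisGroup K} (hpair : ZpExtension.IsTopGeneratorPair κ₁ κ₂ γ₁ γ₂)
    (hur₁ : ∀ v : HeightOneSpectrum (𝓞 K), v ≠ 𝔭 → ∀ 𝔓 ∈ v.primesAbove,
      𝔓.inertia (absoluteGaloisGroup K) ≤ κ₁.kerSubgroup)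
    {c : absoluteGaloisGroup ℚ} (hc : c ∉ Set.range (absGaloisRestrict ℚ K))
    {τ : absoluteGaloisGroup K → absoluteGaloisGroup K}
    (hτ : ∀ σ, absGaloisRestrict ℚ K (τ σ) = c * (absGaloisRestrict ℚ K σ)⁻¹ * c⁻¹) :
    ∃ (r₁ r₂ : FramedGaloisRep K (PadicAlgCl p) 1) (u v₁ v₂ : ℂ_[p]) (m : ℕ), 0 < m ∧
      FactorsThroughPair κ₁ κ₂ r₁ ∧ FactorsThroughPair κ₁ κ₂ r₂ ∧
      avatarValueAt r₁ γ₁ = u ∧ avatarValueAt r₁ γ₂ = 1 ∧ avatarValueAt r₂ γ₁ = v₁ ∧ avatarValueAt r₂ γ₂ = v₂ ∧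
      ‖u - 1‖ < ‖(p : ℂ_[p])‖ ∧ ‖v₁ - 1‖ < ‖(p : ℂ_[p])‖ ∧ ‖v₂ - 1‖ < ‖(p : ℂ_[p])‖ ∧
      (∀ n : ℕ, 0 < n → u ^ n ≠ 1) ∧ (∀ n : ℕ, 0 < n → v₂ ^ n ≠ 1) ∧
      ∀ i j : ℕ, ∃ (ψ : HeckeCharacter K) (r : FramedGaloisRep K (PadicAlgCl p) 1) (L : ℂ → ℂ),
        ψ.HasInfinityType (fun _ ↦ ((m * (i + 1) : ℕ) : ℤ)) (fun _ ↦ -((m * (j + 1) : ℕ) : ℤ)) ∧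
        (∀ w : HeightOneSpectrum (𝓞 K), ψ.IsUnramifiedAt w) ∧ IsPAdicAvatarOf ι' ψ r ∧
        FactorsThroughPair κ₁ κ₂ r ∧ Differentiable ℂ L ∧
        (∀ s : ℂ, ((m * (i + 1) : ℕ) : ℝ) + 2 < s.re → L s = rankinSelbergEulerProductHecke Dt.f ψ s) ∧
        (∀ g : absoluteGaloisGroup K, avatarValueAt r g = avatarValueAt r₁ g ^ (i + 1) * avatarValueAt r₂ g ^ (j + 1)) ∧
        avatarValueAt r γ₁ = v₁ ^ (j + 1) * u ^ (i + 1) ∧ avatarValueAt r γ₂ = v₂ ^ (j + 1) := by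
  -- adapted from `…ThinComb.GridSupply.gridSupply` (g37): same construction, the two base characters kept
  classical
  have hp : p.Prime := Fact.out
  haveI : IsTotallyComplex K := hK.2
  haveI : IsGalois ℚ K := Literature.FieldTheory.Galois.isGalois_of_finrank_eq_two hK.1
  set e := (FramedRep.unitsContinuousMulEquivOfUnique (Fin 1) (PadicAlgCl p) :
    (PadicAlgCl p)ˣ →ₜ* GL (Fin 1) (PadicAlgCl p)) with he
  -- an everywhere-unramified character of type `(k, 0)`, `k > 0`, and its vertical character
  obtain ⟨k, Ψ, hk, hΨt, hΨu⟩ := HeckeCharacter.exists_hasInfinityType_pos_zero_unramified (K := K) hK.1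
  obtain ⟨M, χ, hM, hall, hsmall, hχγ₂, hntors⟩ :=
    VerticalCharacter.exists_verticalCharacter ι' hK hp2 h3' hne hι hpair hur₁ hk hΨt hΨu
  have hval : ∀ (n : ℕ) (g : absoluteGaloisGroup K),
      avatarValueAt (e.comp (χ ^ n)) g = (((χ g : (PadicAlgCl p)ˣ) : PadicAlgCl p) : ℂ_[p]) ^ n := by
    intro n g
    simp only [he, avatarValueAt_unitsChar, ContinuousMonoidHom.pow_apply, Units.val_pow_eq_pow_val, PadicComplex.coe_eq, map_pow]
  -- the two base characters: `r₁ = χ`, `r₂ = χ ∘ τ` (the reflected partner of `χ`)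
  set ρ : ℕ → (absoluteGaloisGroup K →ₜ* (PadicAlgCl p)ˣ) := fun j ↦
    (detChar (FramedGaloisRep.outerConj c (e.comp (χ ^ (j + 1)))))⁻¹ with hρ
  have hρval : ∀ (j : ℕ) (g' : absoluteGaloisGroup K),
      avatarValueAt (e.comp (ρ j)) g' = avatarValueAt (e.comp (χ ^ (j + 1))) (τ g') :=
    fun j g' ↦ ReflectedAvatar.avatarValueAt_reflected_eq_conjInv hτ _ g'
  have hρκ : ∀ j : ℕ, FactorsThroughPair κ₁ κ₂ (e.comp (ρ j)) := fun j ↦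
    ReflectedAvatar.factorsThroughPair_reflected hK hpair hτ (hall (j + 1)).2
  set r₁ : FramedGaloisRep K (PadicAlgCl p) 1 := e.comp (χ ^ 1) with hr₁
  set r₂ : FramedGaloisRep K (PadicAlgCl p) 1 := e.comp (ρ 0) with hr₂
  have hr₁val : ∀ g : absoluteGaloisGroup K, avatarValueAt r₁ g = (((χ g : (PadicAlgCl p)ˣ) : PadicAlgCl p) : ℂ_[p]) := by
    intro g; rw [hr₁, hval, pow_one]
  have hr₂val : ∀ g : absoluteGaloisGroup K, avatarValueAt r₂ g = (((χ (τ g) : (PadicAlgCl p)ˣ) : PadicAlgCl p) : ℂ_[p]) := by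
    intro g; rw [hr₂, hρval, hval, pow_one]
  have hρpow : ∀ (j : ℕ) (g : absoluteGaloisGroup K), avatarValueAt (e.comp (ρ j)) g = avatarValueAt r₂ g ^ (j + 1) := by
    intro j g; rw [hρval, hval, hr₂val]
  set u : ℂ_[p] := (((χ γ₁ : (PadicAlgCl p)ˣ) : PadicAlgCl p) : ℂ_[p]) with hu_def
  set v₁ : ℂ_[p] := (((χ (τ γ₁) : (PadicAlgCl p)ˣ) : PadicAlgCl p) : ℂ_[p]) with hv₁_def
  set v₂ : ℂ_[p] := (((χ (τ γ₂) : (PadicAlgCl p)ˣ) : PadicAlgCl p) : ℂ_[p]) with hv₂_def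
  have hu1 : avatarValueAt (e.comp (χ ^ 1)) γ₁ = u := by rw [hval, pow_one]
  have hv₁1 : avatarValueAt (e.comp (χ ^ 1)) (τ γ₁) = v₁ := by rw [hval, pow_one]
  have hv₂1 : avatarValueAt (e.comp (χ ^ 1)) (τ γ₂) = v₂ := by rw [hval, pow_one]
  have hu_small : ‖u - 1‖ < ‖(p : ℂ_[p])‖ := by rw [← hu1]; exact hsmall 1 γ₁
  have hv₁_small : ‖v₁ - 1‖ < ‖(p : ℂ_[p])‖ := by rw [← hv₁1]; exact hsmall 1 _
  have hv₂_small : ‖v₂ - 1‖ < ‖(p : ℂ_[p])‖ := by rw [← hv₂1]; exact hsmall 1 _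
  -- non-torsion: `χ(γ₁)` (`κ₁ γ₁ = 1`) and `χ(τ γ₂)` (`κ₁ (τ γ₂) ≠ 0`, the frame geometry)
  have hκγ₁ : κ₁ γ₁ ≠ 1 := by
    rw [hpair.left]; exact fun h ↦ one_ne_zero (Multiplicative.ofAdd.injective (h.trans ofAdd_zero.symm))
  have hκτγ₂ : κ₁ (τ γ₂) ≠ 1 := by
    have h := FrameInvolution.frameMatrixOf_zero_one_ne_zero (p := p) hK hpair
      (Literature.NumberTheory.NumberFields.under_eq_under_of_natCast_mem K h3 h3') hne hur₁ hc hτ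
    rw [IwasawaAlgebra₂.frameMatrixOf_apply_zero_one] at h
    exact fun h1 ↦ h (by rw [h1]; rfl)
  have hu_pow : ∀ n : ℕ, 0 < n → u ^ n ≠ 1 := by
    intro n hn hun
    apply hntors n hn γ₁ hκγ₁
    have : ((((χ γ₁ ^ n : (PadicAlgCl p)ˣ)) : PadicAlgCl p) : ℂ_[p]) = ((1 : PadicAlgCl p) : ℂ_[p]) := by
      rw [Units.val_pow_eq_pow_val, PadicComplex.coe_eq, map_pow, ← PadicComplex.coe_eq, ← hu_def, hun, PadicComplex.coe_eq, map_one]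
    rw [PadicComplex.coe_eq, PadicComplex.coe_eq] at this
    exact Units.ext ((algebraMap (PadicAlgCl p) ℂ_[p]).injective this)
  have hv₂_pow : ∀ n : ℕ, 0 < n → v₂ ^ n ≠ 1 := by
    intro n hn hvn
    apply hntors n hn (τ γ₂) hκτγ₂
    have : ((((χ (τ γ₂) ^ n : (PadicAlgCl p)ˣ)) : PadicAlgCl p) : ℂ_[p]) = ((1 : PadicAlgCl p) : ℂ_[p]) := by
      rw [Units.val_pow_eq_pow_val, PadicComplex.coe_eq, map_pow, ← PadicComplex.coe_eq, ← hv₂_def, hvn, PadicComplex.coe_eq,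
        map_one]
    rw [PadicComplex.coe_eq, PadicComplex.coe_eq] at this
    exact Units.ext ((algebraMap (PadicAlgCl p) ℂ_[p]).injective this)
  -- types and ramification of the powers of `Ψ`
  have htypeΨ : ∀ n : ℕ, (Ψ ^ n).HasInfinityType (fun _ ↦ ((k * n : ℕ) : ℤ)) (fun _ ↦ (0 : ℤ)) := by
    intro n
    have h1 := hΨt.zpow' (n : ℤ)
    rw [zpow_natCast] at h1
    convert h1 using 2 <;> simp only [Pi.smul_apply, smul_eq_mul] <;> push_cast <;> ring
  have hunrΨ : ∀ (n : ℕ) (w : HeightOneSpectrum (𝓞 K)), (Ψ ^ n).IsUnramifiedAt w :=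
    fun n w ↦ isUnramifiedAt_pow' (hΨu w) _
  have hr₁γ₁ : avatarValueAt r₁ γ₁ = u := by rw [hr₁val]
  have hr₁γ₂ : avatarValueAt r₁ γ₂ = 1 := by rw [hr₁val, hχγ₂, Units.val_one, PadicComplex.coe_eq, map_one]
  have hr₂γ₁ : avatarValueAt r₂ γ₁ = v₁ := by rw [hr₂val]
  have hr₂γ₂ : avatarValueAt r₂ γ₂ = v₂ := by rw [hr₂val]
  refine ⟨r₁, r₂, u, v₁, v₂, k * M, Nat.mul_pos hk hM, (hall 1).2, hρκ 0, hr₁γ₁, hr₁γ₂, hr₂γ₁, hr₂γ₂, hu_small, hv₁_small,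
    hv₂_small, hu_pow, hv₂_pow, fun i j ↦ ?_⟩
  -- the reflected partner of `Ψ^{M(j+1)}`: `ψ₂ = (Ψ^{M(j+1)} ∘ c̄)⁻¹` with avatar `e ∘ ρ j`
  set g := absGaloisQuot ℚ K c with hgdef
  have hr₂' : IsPAdicAvatarOf ι' (HeckeCharacter.galConj g (Ψ ^ (M * (j + 1))))⁻¹ (e.comp (ρ j)) :=
    ReflectedAvatar.isPAdicAvatarOf_reflected ι' c (hall (j + 1)).1
  have hinfj : (Ψ ^ (M * (j + 1))).HasInfinityType (fun _ ↦ ((k * (M * (j + 1)) : ℕ) : ℤ)) (fun _ ↦ -((0 : ℕ) : ℤ)) := by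
    simpa only [Nat.cast_zero, neg_zero] using htypeΨ (M * (j + 1))
  have hinf₂ : (HeckeCharacter.galConj g (Ψ ^ (M * (j + 1))))⁻¹.HasInfinityType (fun _ ↦ ((0 : ℕ) : ℤ))
      (fun _ ↦ -((k * (M * (j + 1)) : ℕ) : ℤ)) := ReflectedAvatar.hasInfinityType_reflectedChar hK hc hinfj
  have hunr₂ : ∀ w : HeightOneSpectrum (𝓞 K), (HeckeCharacter.galConj g (Ψ ^ (M * (j + 1))))⁻¹.IsUnramifiedAt w :=
    ReflectedAvatar.isUnramifiedAt_reflectedChar g (hunrΨ _)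
  -- the datum `ψ = Ψ^{M(i+1)} · ψ₂`, `r = e ∘ (χ^{i+1} · ρ j)`, of type `(kM(i+1), −kM(j+1))`
  have ha : 1 ≤ k * M * (i + 1) := Nat.mul_pos (Nat.mul_pos hk hM) (Nat.succ_pos i)
  have hb : 1 ≤ k * M * (j + 1) := Nat.mul_pos (Nat.mul_pos hk hM) (Nat.succ_pos j)
  set ψ : HeckeCharacter K := Ψ ^ (M * (i + 1)) * (HeckeCharacter.galConj g (Ψ ^ (M * (j + 1))))⁻¹ with hψ_def
  have hinf : ψ.HasInfinityType (fun _ ↦ ((k * M * (i + 1) : ℕ) : ℤ)) (fun _ ↦ -((k * M * (j + 1) : ℕ) : ℤ)) := by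
    have h := (htypeΨ (M * (i + 1))).mul' hinf₂
    convert h using 2 <;> simp only [Pi.add_apply] <;> push_cast <;> ring
  have hunr : ∀ w : HeightOneSpectrum (𝓞 K), ψ.IsUnramifiedAt w := fun w ↦ (hunrΨ _ w).mul' (hunr₂ w)
  have hr : IsPAdicAvatarOf ι' ψ (e.comp (χ ^ (i + 1) * ρ j)) :=
    isPAdicAvatarOf_mul ι' (hall (i + 1)).1 hr₂' (fun w _ _ ↦ ⟨hunrΨ _ w, hunr₂ w⟩)
  have hrκ : FactorsThroughPair κ₁ κ₂ (e.comp (χ ^ (i + 1) * ρ j)) :=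
    FibredSupply.factorsThroughPair_unitsChar_mul (hall (i + 1)).2 (hρκ j)
  obtain ⟨L, hLd, hLe⟩ := jacquet1972_functionalEquation_rankinSelbergHecke_cone.exists_entire hJ hK Dt.isNewformOf.1 hH ψ ha hb
    hunr hinf
  -- its values: products of powers of the two base characters
  have hprod : ∀ g' : absoluteGaloisGroup K,
      avatarValueAt (e.comp (χ ^ (i + 1) * ρ j)) g' = avatarValueAt r₁ g' ^ (i + 1) * avatarValueAt r₂ g' ^ (j + 1) := by
    intro g'
    rw [he, avatarValueAt_unitsChar_mul, ← he, hρpow, hval, hr₁val]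
  have hx : avatarValueAt (e.comp (χ ^ (i + 1) * ρ j)) γ₁ = v₁ ^ (j + 1) * u ^ (i + 1) := by
    rw [hprod, hr₁γ₁, hr₂γ₁, mul_comm]
  have hy : avatarValueAt (e.comp (χ ^ (i + 1) * ρ j)) γ₂ = v₂ ^ (j + 1) := by
    rw [hprod, hr₁γ₂, hr₂γ₂, one_pow, one_mul]
  exact ⟨ψ, e.comp (χ ^ (i + 1) * ρ j), L, hinf, hunr, hr, hrκ, hLd, hLe, hprod, hx, hy⟩

end Summit.BirchSwinnertonDyer.BirchSwinnertonDyer.Theorems.UniversalToricDescentThinComb.CharacterGrid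

end
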